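import Mathlib
import Summits.Ventures.LatticeQCDFlow.Scaling.U1LayerWords

/-!
# LatticeQCDFlow / Scaling — `U(1)` slab moments: the vertical moments of the slab cost are
# constant below order four, and the order-four kernel with vanishing marginals

HONEST FRAMING: exact (Metropolis-corrected) sampling algorithms for lattice gauge theory;
figures of merit are autocorrelation/cost numbers at stated couplings and volumes; no
continuum-physics claim.

Venture `LatticeQCDFlow` (cell pub-lqcd), topic `Scaling`, FANOUT row 30 (lean-1) — OUR WORK (LEAD
LINE 230 (G3′)), lattice file 2 of the slab-chain proof of (LC) at every separation: the MOMENT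
HYPOTHESIS of `Scaling/SlabKernel.lean` (`SlabChain.Moments`, `g = 4`) for compact `U(1)`.  With the
layer data of `Scaling/U1LayerWords.lean` (horizontal variables `e, e' : LEdge → U(1)` of two
consecutive layers, vertical variables `v : LSite → U(1)` of the slab between them, all Haar):
* `plaqU`, `slabCost e v e' = Σ_ℓ Re (v(src ℓ) e(ℓ) v(tgt ℓ)⁻¹ e'(ℓ)⁻¹)` — the sum of the `U(1)`
  cosines of the lateral plaquettes of a slab;
* `slabCost_pow_eq_sum` — `(slabCost)^m = 2^{-m} Σ_{(w,ε)} χ_{w,ε}(e e'⁻¹) · V_{w,ε}(v)` over signed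
  words (horizontal character times vertical factor); `integral_slabCost_pow` — integrating the
  vertical variables keeps exactly the CLOSED words;
* **`integral_slabCost_pow_eq_const`** — for `L ≥ 4` and `m ≤ 3` the vertical moment
  `∫ slabCost(e,v,e')^m dv` is the constant `momentConst m = 2^{-m} #{closed words}` (girth lemma
  `wordChar_eq_one_of_closed`);
* order four: `slabCost e v e' = slabCost (e e'⁻¹) v 1`, the kernel `K4 e e' = ∫ slabCost^4 dv` is a
  function of `e e'⁻¹`, `rho4 e e' = (K4 e e' − c4)/24` with `c4 = ∫ K4(r, 1) dr` has VANISHING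
  MARGINALS in each variable (`integral_rho4_left/right`, translation and inversion invariance of
  the Haar product), is bounded and measurable;
* bounds and measurability of `slabCost` (`abs_slabCost_le`, `continuous_slabCost`).
Elementary; nothing is cited as a fact; `def`s `plaqU`, `slabCost`, `momentConst`, `K4`, `c4`,
`rho4`; no `sorry`.
-/

noncomputable section

open MeasureTheory Filter Finset
open Literature.MathematicalPhysics.QuantumFieldTheory

namespace Summit.Ventures.LatticeQCDFlow.Theory2.Lattice.U1Layer

variable {d L : ℕ} [NeZero L] {a : Fin d}

/-! ## 1. The slab cost and its expansion in signed words -/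

/-- The `U(1)` holonomy of the lateral plaquette through the layer edge `ℓ`:
`v(src ℓ) · e(ℓ) · v(tgt ℓ)⁻¹ · e'(ℓ)⁻¹`. [folklore] -/
def plaqU (e : LEdge d L a → Circle) (v : LSite d L a → Circle) (e' : LEdge d L a → Circle)
    (ℓ : LEdge d L a) : Circle :=
  v ℓ.src * e ℓ * (v ℓ.tgt)⁻¹ * (e' ℓ)⁻¹

/-- **The slab cost**: the sum of the cosines of the lateral plaquettes of a slab. [folklore] -/
def slabCost (e : LEdge d L a → Circle) (v : LSite d L a → Circle) (e' : LEdge d L a → Circle) : ℝ :=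
  ∑ ℓ, ((plaqU e v e' ℓ : Circle) : ℂ).re

omit [NeZero L] in
/-- The plaquette holonomy splits as horizontal ratio times vertical ratio. [folklore] -/
theorem plaqU_eq (e : LEdge d L a → Circle) (v : LSite d L a → Circle) (e' : LEdge d L a → Circle)
    (ℓ : LEdge d L a) : plaqU e v e' ℓ = (e * e'⁻¹) ℓ * (v ℓ.src * (v ℓ.tgt)⁻¹) := by
  simp only [plaqU, Pi.mul_apply, Pi.inv_apply]
  simp only [mul_comm, mul_left_comm, mul_assoc]

/-- The slab cost depends on the horizontal variables through `e e'⁻¹` only. [folklore] -/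
theorem slabCost_eq_mul_inv (e : LEdge d L a → Circle) (v : LSite d L a → Circle)
    (e' : LEdge d L a → Circle) : slabCost e v e' = slabCost (e * e'⁻¹) v 1 := by
  unfold slabCost
  refine sum_congr rfl fun ℓ _ => ?_
  rw [plaqU_eq, plaqU_eq]
  simp

/-- The real part of a unit complex number: `Re z = (z + z⁻¹)/2 = ½ Σ_{b} z^{sgn b}`. [folklore] -/
theorem re_coe_eq_half_sum (z : Circle) :
    (((z : ℂ).re : ℝ) : ℂ) = 2⁻¹ * ∑ b : Bool, ((z ^ sgn b : Circle) : ℂ) := by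
  rw [Fintype.sum_bool]
  simp only [sgn, if_true, Bool.false_eq_true, if_false, zpow_one, zpow_neg, Circle.coe_inv_eq_conj]
  rw [Complex.add_conj]
  push_cast
  ring

/-- `|slabCost| ≤ #LEdge`. [folklore] -/
theorem abs_slabCost_le (e : LEdge d L a → Circle) (v : LSite d L a → Circle)
    (e' : LEdge d L a → Circle) : |slabCost e v e'| ≤ Fintype.card (LEdge d L a) := by
  unfold slabCost
  refine (Finset.abs_sum_le_sum_abs _ _).trans ?_
  calc ∑ ℓ, |((plaqU e v e' ℓ : Circle) : ℂ).re| ≤ ∑ _ℓ : LEdge d L a, (1 : ℝ) :=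
        sum_le_sum fun ℓ _ => (Complex.abs_re_le_norm _).trans (le_of_eq (Circle.norm_coe _))
    _ = Fintype.card (LEdge d L a) := by simp

/-- The slab cost is jointly continuous. [folklore] -/
theorem continuous_slabCost :
    Continuous fun p : (LEdge d L a → Circle) × (LSite d L a → Circle) × (LEdge d L a → Circle) =>
      slabCost p.1 p.2.1 p.2.2 := by
  unfold slabCost plaqU
  refine continuous_finsetSum _ fun ℓ _ => ?_
  refine Complex.continuous_re.comp (continuous_subtype_val.comp ?_)
  fun_prop

/-- **Expansion of a power of the slab cost in signed words**:
`(slabCost)^m = 2^{-m} Σ_w Σ_ε χ_{w,ε}(e e'⁻¹) · V_{w,ε}(v)`. [folklore] -/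
theorem slabCost_pow_eq_sum (e : LEdge d L a → Circle) (v : LSite d L a → Circle)
    (e' : LEdge d L a → Circle) (m : ℕ) :
    ((slabCost e v e' : ℝ) : ℂ) ^ m = (2⁻¹ : ℂ) ^ m *
      ∑ w : Fin m → LEdge d L a, ∑ ε : Fin m → Bool,
        ((wordChar w ε (e * e'⁻¹) : Circle) : ℂ) * ((vertFactor w ε v : Circle) : ℂ) := by
  unfold slabCost
  push_cast
  rw [Fintype.sum_pow]
  rw [Finset.mul_sum]
  refine sum_congr rfl fun w _ => ?_
  simp_rw [re_coe_eq_half_sum]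
  rw [prod_mul_distrib, prod_const, card_univ, Fintype.card_fin, Fintype.prod_sum]
  congr 1
  refine sum_congr rfl fun ε _ => ?_
  have hprod : wordChar w ε (e * e'⁻¹) * vertFactor w ε v = ∏ l, plaqU e v e' (w l) ^ sgn (ε l) := by
    unfold wordChar vertFactor
    rw [← prod_mul_distrib]
    refine prod_congr rfl fun l _ => ?_
    rw [plaqU_eq]
    exact (mul_zpow _ _ _).symm
  rw [← Circle.coe_mul, hprod, ← Circle.coeHom_apply, map_prod]
  simp

omit [NeZero L] in
/-- The vertical factor of a word is a continuous function of the vertical variables. [folklore] -/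
theorem continuous_vertFactor {m : ℕ} (w : Fin m → LEdge d L a) (ε : Fin m → Bool) :
    Continuous fun v : LSite d L a → Circle => ((vertFactor w ε v : Circle) : ℂ) := by
  have h1 : ∀ l, Continuous fun v : LSite d L a → Circle =>
      ((v (w l).src * (v (w l).tgt)⁻¹) ^ sgn (ε l) : Circle) := fun l => by fun_prop
  have h2 : Continuous fun v : LSite d L a → Circle => (vertFactor w ε v : Circle) := by
    unfold vertFactor
    exact continuous_finsetProd _ fun l _ => h1 l
  exact continuous_subtype_val.comp h2

/-- **The vertical moments**: `∫ slabCost(e,v,e')^m dv = 2^{-m} Σ_{(w,ε) closed} χ_{w,ε}(e e'⁻¹)`.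
[folklore] -/
theorem integral_slabCost_pow (e : LEdge d L a → Circle) (e' : LEdge d L a → Circle) (m : ℕ) :
    ∫ v, ((slabCost e v e' : ℝ) : ℂ) ^ m ∂(Measure.pi fun _ : LSite d L a => haarProbability Circle) =
      (2⁻¹ : ℂ) ^ m * ∑ w : Fin m → LEdge d L a, ∑ ε : Fin m → Bool,
        ((wordChar w ε (e * e'⁻¹) : Circle) : ℂ) * (if boundaryCharge w ε = 0 then 1 else 0) := by
  simp_rw [slabCost_pow_eq_sum]
  rw [integral_const_mul]
  congr 1
  have hint : ∀ (w : Fin m → LEdge d L a) (ε : Fin m → Bool),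
      Integrable (fun v => ((wordChar w ε (e * e'⁻¹) : Circle) : ℂ) * ((vertFactor w ε v : Circle) : ℂ))
        (Measure.pi fun _ : LSite d L a => haarProbability Circle) := fun w ε =>
    Integrable.of_bound ((continuous_vertFactor w ε).measurable.const_mul _).aestronglyMeasurable 1
      (Eventually.of_forall fun v => by rw [norm_mul, Circle.norm_coe, Circle.norm_coe, one_mul])
  rw [integral_finsetSum _ fun w _ => integrable_finsetSum _ fun ε _ => hint w ε]
  refine sum_congr rfl fun w _ => ?_
  rw [integral_finsetSum _ fun ε _ => hint w ε]
  refine sum_congr rfl fun ε _ => ?_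
  rw [integral_const_mul, integral_vertFactor]

/-! ## 2. Moments of order `≤ 3` are constant -/

/-- The constant value of the vertical moment of order `m ≤ 3`: `2^{-m}` times the number of closed
signed words of length `m`. [folklore] -/
def momentConst (d L : ℕ) [NeZero L] (a : Fin d) (m : ℕ) : ℂ :=
  (2⁻¹ : ℂ) ^ m * ((univ.filter fun p : (Fin m → LEdge d L a) × (Fin m → Bool) =>
    boundaryCharge p.1 p.2 = 0).card : ℂ)

/-- **Below order four the vertical moments are constant** (`L ≥ 4`, girth of the layer). [folklore] -/
theorem integral_slabCost_pow_eq_const (hL : 4 ≤ L) {m : ℕ} (hm : m ≤ 3)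
    (e e' : LEdge d L a → Circle) :
    ∫ v, ((slabCost e v e' : ℝ) : ℂ) ^ m ∂(Measure.pi fun _ : LSite d L a => haarProbability Circle) =
      momentConst d L a m := by
  rw [integral_slabCost_pow, momentConst]
  congr 1
  rw [← Fintype.sum_prod_type', Finset.card_eq_sum_ones, Nat.cast_sum, Finset.sum_filter]
  push_cast
  refine sum_congr rfl fun p _ => ?_
  split_ifs with h
  · rw [wordChar_eq_one_of_closed hL hm p.1 p.2 h, Circle.coe_one, one_mul]
  · rw [mul_zero]

/-! ## 3. Order four: the kernel and its centred version -/

/-- The vertical moment of order four, `K4 e e' = ∫ slabCost(e,v,e')⁴ dv`. [folklore] -/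
def K4 (e e' : LEdge d L a → Circle) : ℂ :=
  ∫ v, ((slabCost e v e' : ℝ) : ℂ) ^ 4 ∂(Measure.pi fun _ : LSite d L a => haarProbability Circle)

/-- `K4` is a function of `e e'⁻¹`. [folklore] -/
theorem K4_eq (e e' : LEdge d L a → Circle) : K4 e e' = K4 (e * e'⁻¹) 1 := by
  unfold K4
  simp_rw [slabCost_eq_mul_inv e _ e']

/-- The mean of the order-four moment, `c4 = ∫ K4(r, 1) dr`. [folklore] -/
def c4 (d L : ℕ) [NeZero L] (a : Fin d) : ℂ :=
  ∫ r, K4 (d := d) (L := L) (a := a) r 1 ∂(Measure.pi fun _ : LEdge d L a => haarProbability Circle)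

/-- **The centred order-four kernel** `ρ(e, e') = (K4(e,e') − c4)/4!`. [folklore] -/
def rho4 (e e' : LEdge d L a → Circle) : ℂ := (K4 e e' - c4 d L a) / 24

/-- `K4` is bounded: `‖K4‖ ≤ (#LEdge)^4`. [folklore] -/
theorem norm_K4_le (e e' : LEdge d L a → Circle) :
    ‖K4 e e'‖ ≤ (Fintype.card (LEdge d L a) : ℝ) ^ 4 := by
  unfold K4
  have h := norm_integral_le_of_norm_le_const
    (μ := Measure.pi fun _ : LSite d L a => haarProbability Circle)
    (f := fun v => ((slabCost e v e' : ℝ) : ℂ) ^ 4) (C := (Fintype.card (LEdge d L a) : ℝ) ^ 4)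
    (Eventually.of_forall fun v => by
      rw [norm_pow, Complex.norm_real, Real.norm_eq_abs]
      exact pow_le_pow_left₀ (abs_nonneg _) (abs_slabCost_le e v e') 4)
  simpa using h

/-- `K4(·, e'₀)` is continuous (a parametric integral of a bounded continuous function over a
compact probability space). [folklore] -/
theorem continuous_K4_left (e'₀ : LEdge d L a → Circle) : Continuous fun e : LEdge d L a → Circle =>
    K4 e e'₀ := by
  unfold K4
  have hc : Continuous (Function.uncurry fun (e : LEdge d L a → Circle) (v : LSite d L a → Circle) =>
      ((slabCost e v e'₀ : ℝ) : ℂ) ^ 4) :=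
    (Complex.continuous_ofReal.comp (continuous_slabCost.comp (continuous_fst.prodMk
      ((continuous_snd).prodMk continuous_const)))).pow 4
  have h := continuous_parametric_integral_of_continuous
    (μ := Measure.pi fun _ : LSite d L a => haarProbability Circle) hc isCompact_univ
  simpa [Measure.restrict_univ] using h

/-- `K4` is jointly measurable. [folklore] -/
theorem measurable_K4 : Measurable fun p : (LEdge d L a → Circle) × (LEdge d L a → Circle) =>
    K4 p.1 p.2 := by
  have h : (fun p : (LEdge d L a → Circle) × (LEdge d L a → Circle) => K4 p.1 p.2) =
      (fun r => K4 r 1) ∘ fun p => p.1 * p.2⁻¹ := by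
    funext p; simp [K4_eq p.1 p.2]
  rw [h]
  exact (continuous_K4_left 1).measurable.comp (measurable_fst.mul measurable_snd.inv)

/-- `rho4` is jointly measurable. [folklore] -/
theorem measurable_rho4 : Measurable (Function.uncurry (rho4 (d := d) (L := L) (a := a))) := by
  have h : Function.uncurry (rho4 (d := d) (L := L) (a := a)) =
      fun p => (K4 p.1 p.2 - c4 d L a) / 24 := by
    funext p; rfl
  rw [h]
  exact (measurable_K4.sub measurable_const).div_const _

/-- `rho4` is bounded. [folklore] -/
theorem norm_rho4_le (e e' : LEdge d L a → Circle) :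
    ‖rho4 e e'‖ ≤ ((Fintype.card (LEdge d L a) : ℝ) ^ 4 + ‖c4 d L a‖) / 24 := by
  unfold rho4
  rw [norm_div, show ‖(24 : ℂ)‖ = 24 by norm_num]
  exact div_le_div_of_nonneg_right ((norm_sub_le _ _).trans (add_le_add (norm_K4_le e e') le_rfl))
    (by norm_num)

/-- `K4(·, e')` is integrable. [folklore] -/
theorem integrable_K4_left (e' : LEdge d L a → Circle) :
    Integrable (fun e => K4 e e') (Measure.pi fun _ : LEdge d L a => haarProbability Circle) :=
  Integrable.of_bound (measurable_K4.comp (measurable_id.prodMk measurable_const)).aestronglyMeasurable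
    _ (Eventually.of_forall fun e => norm_K4_le e e')

/-- `K4(e, ·)` is integrable. [folklore] -/
theorem integrable_K4_right (e : LEdge d L a → Circle) :
    Integrable (fun e' => K4 e e') (Measure.pi fun _ : LEdge d L a => haarProbability Circle) :=
  Integrable.of_bound (measurable_K4.comp (measurable_const.prodMk measurable_id)).aestronglyMeasurable
    _ (Eventually.of_forall fun e' => norm_K4_le e e')

/-- The centred kernel integrates to zero as soon as `K4` integrates to `c4`. [folklore] -/
theorem integral_rho4_eq_zero_of {f : (LEdge d L a → Circle) → ℂ}
    (hfi : Integrable f (Measure.pi fun _ : LEdge d L a => haarProbability Circle))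
    (hf : ∫ r, f r ∂(Measure.pi fun _ : LEdge d L a => haarProbability Circle) = c4 d L a) :
    ∫ r, (f r - c4 d L a) / 24 ∂(Measure.pi fun _ : LEdge d L a => haarProbability Circle) = 0 := by
  simp_rw [div_eq_mul_inv]
  rw [integral_mul_const, integral_sub hfi (integrable_const _), hf, integral_const, probReal_univ,
    one_smul, sub_self, zero_mul]

/-- **Vanishing first marginal**: `∫ ρ(e, e') de = 0` (right translation invariance of the Haar
product). [folklore] -/
theorem integral_rho4_left (e' : LEdge d L a → Circle) :
    ∫ e, rho4 e e' ∂(Measure.pi fun _ : LEdge d L a => haarProbability Circle) = 0 := by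
  refine integral_rho4_eq_zero_of (integrable_K4_left e') ?_
  have h1 : (fun e => K4 e e') = fun e => (fun r : LEdge d L a → Circle => K4 r 1) (e * e'⁻¹) :=
    funext fun e => K4_eq e e'
  rw [h1, integral_mul_right_eq_self (μ := Measure.pi fun _ : LEdge d L a => haarProbability Circle)
    (fun r : LEdge d L a → Circle => K4 r 1) e'⁻¹]
  rfl

/-- **Vanishing second marginal**: `∫ ρ(e, e') de' = 0` (inversion and left translation invariance
of the Haar product). [folklore] -/
theorem integral_rho4_right (e : LEdge d L a → Circle) :
    ∫ e', rho4 e e' ∂(Measure.pi fun _ : LEdge d L a => haarProbability Circle) = 0 := by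
  refine integral_rho4_eq_zero_of (integrable_K4_right e) ?_
  have h1 : (fun e' => K4 e e') = fun e' => (fun r : LEdge d L a → Circle => K4 (e * r) 1) e'⁻¹ :=
    funext fun e' => K4_eq e e'
  rw [h1, integral_inv_eq_self (μ := Measure.pi fun _ : LEdge d L a => haarProbability Circle)
    (fun r : LEdge d L a → Circle => K4 (e * r) 1),
    integral_mul_left_eq_self (μ := Measure.pi fun _ : LEdge d L a => haarProbability Circle)
    (fun r : LEdge d L a → Circle => K4 r 1) e]
  rfl

/-- **The order-four moment identity**: `∫ slabCost⁴ dv = c4 + 4!·ρ(e,e')`. [folklore] -/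
theorem integral_slabCost_pow_four (e e' : LEdge d L a → Circle) :
    ∫ v, ((slabCost e v e' : ℝ) : ℂ) ^ 4 ∂(Measure.pi fun _ : LSite d L a => haarProbability Circle) =
      c4 d L a + ((4 : ℕ).factorial : ℂ) * rho4 e e' := by
  rw [show ((4 : ℕ).factorial : ℂ) = 24 by norm_num [Nat.factorial], rho4, ← K4]
  ring

end Summit.Ventures.LatticeQCDFlow.Theory2.Lattice.U1Layer

end
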